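import Summits.CriticalPhenomena.Ising3DConformalLimit.Theorems.RotationUpgradeFromTwoPoint.Negative.GaussianCoupling
import HarnessLib

/-!
# Gaussian (Wick) families with a reflection-positive two-point kernel are reflection positive at all orders

THEOREM-ONLY support file for the crux `RotationUpgradeFromTwoPoint` (item stmt-CriticalPhenomena-8367;
line `null-laplacian-edge-gaussianity`), negative side: it is the engine behind the kernel-checked form of the
paper draft's Remark "the Lebowitz sign is what excludes the edge `Δ = 1/2`" (HOME/nine-mirror-isotropy,
Remark 5.14: a reflection positive Gaussian scale mixture with round two-point function and `U₄ > 0`), see the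
sibling file `EdgeScaleMixture.lean`.

THE THEOREM (`gaussianFamily_clusterRP`).  Let `K : α → α → ℝ` be a symmetric kernel, `θ : α → α` an involution
with `K (θ p) (θ q) = K p q`, and `H ⊆ α` a set on which `K` is REFLECTION POSITIVE AT THE TWO-POINT LEVEL:
`∑ c_i c_j K(θ p_i, p_j) ≥ 0` for all finite families `p_i ∈ H`.  Then the Gaussian (Wick, hafnian) family
`G_{2k}(z) = 𝒢_k[K](z) = ∑_{pairings} ∏ K(z_i, z_j)` (the tree's `pairingSum`), `G_{odd} = 0`, is reflection positive
AT ALL ORDERS in the Osterwalder–Schrader cluster form: for finitely many finite clusters `A^a ⊂ H` and reals `c_a`,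
`∑_{a,b} c_a c_b G(θA^a ⊔ A^b) ≥ 0`.  (Glimm–Jaffe, *Quantum Physics*, Thm 6.2.2 / Cor 6.2.3: the Gaussian measure of
a reflection positive covariance is reflection positive.)

THE PROOF is probabilistic and finite-dimensional (no Fock space, no combinatorics of matchings beyond the tree's
Wick theorem `Literature.Probability.Distributions.GaussianWick.integral_prod_eq_pairingSum`).  Index the cluster
points by the finite type `ι = Σ a, Fin (k a)`; let `B_{st} = K(θ p_s, p_t)` (positive semidefinite by two-point RP)
and let `D` be the symmetric matrix with off-diagonal entries `K(p_s, p_t) − B_{st}` and a dominant diagonal (positive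
semidefinite by diagonal dominance, `posSemidef_of_diag_dominant` of the sibling file `GaussianCoupling.lean`; the diagonal never enters a hafnian, whose pairs
are pairs of DISTINCT positions).  With independent `U ~ N(0,B)`, `V, V' ~ N(0,D)` (Mathlib's `multivariateGaussian`
on a product space) put `ξ = U + V`, `η = U + V'`: then `Cov(ξ_s, ξ_t) = Cov(η_s, η_t) = K(p_s,p_t)` (`s ≠ t`) and
`Cov(ξ_s, η_t) = K(θ p_s, p_t)`, so by Wick's theorem `G(θA^a ⊔ A^b) = E[∏_{i∈A^a} ξ_i ∏_{j∈A^b} η_j]`, and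
`∑ c_a c_b G(θA^a ⊔ A^b) = E[F(ξ)F(η)] = ∫ (E_V F(u + V))² dN(0,B)(u) ≥ 0` (Fubini).

O(3) writer seat, cell pub-ising3x, 2026-08-25; supports item stmt-CriticalPhenomena-8367.  Standard axioms only.
-/

noncomputable section

open MeasureTheory ProbabilityTheory Finset
open Literature.Probability.LatticeModels (pairingSum pairIdx)
open Literature.Probability.Distributions.GaussianWick
open scoped BigOperators

namespace Summit.CriticalPhenomena.Ising3DConformalLimit.RotationUpgradeFromTwoPointNegative

/-! ## §3 The theorem -/

/-- **Gaussian families with a reflection positive two-point kernel are reflection positive at all orders**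
(Osterwalder–Schrader positivity in the cluster form).  `K` symmetric, `θ` an involution with `K ∘ (θ × θ) = K`,
two-point reflection positivity of `K` on `H`; conclusion for the Wick family `G_{2k} = 𝒢_k[K]`, `G_{odd} = 0`:
`∑_{a,b} c_a c_b G(θA^a ⊔ A^b) ≥ 0` for all finite families of finite clusters `A^a ⊂ H`.
[cite: GlimmJaffeQP1987, Thm 6.2.2 and Cor 6.2.3] -/
theorem gaussianFamily_clusterRP {α : Type*} (K : α → α → ℝ) (θ : α → α) (H : Set α)
    (hK : ∀ p q, K p q = K q p) (hθK : ∀ p q, K (θ p) (θ q) = K p q) (hθ : Function.Involutive θ)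
    (hRP : ∀ (m : ℕ) (p : Fin m → α) (c : Fin m → ℝ), (∀ i, p i ∈ H) →
      0 ≤ ∑ i, ∑ j, c i * c j * K (θ (p i)) (p j))
    (m : ℕ) (k : Fin m → ℕ) (x : (a : Fin m) → Fin (k a) → α) (hx : ∀ a i, x a i ∈ H) (c : Fin m → ℝ) :
    0 ≤ ∑ a, ∑ b, c a * c b *
      (if h : Even (k a + k b) then
        pairingSum K ((k a + k b) / 2)
          (fun i => Fin.append (fun i => θ (x a i)) (x b) (Fin.cast (Nat.two_mul_div_two_of_even h) i))
       else 0) := by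
  classical
  -- §3.1 the index type, the points, the two matrices
  let ι := (a : Fin m) × Fin (k a)
  let pts : ι → α := fun s => x s.1 s.2
  let B : Matrix ι ι ℝ := fun s t => K (θ (pts s)) (pts t)
  let M : Matrix ι ι ℝ := fun s t => K (pts s) (pts t) - B s t
  let D : Matrix ι ι ℝ := fun s t => if s = t then (∑ u, |M s u|) + 1 else M s t
  have hBsymm : ∀ s t, B s t = B t s := by
    intro s t
    show K (θ (pts s)) (pts t) = K (θ (pts t)) (pts s)
    rw [hK (θ (pts t)) (pts s), ← hθK (pts s) (θ (pts t)), hθ (pts t)]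
  have hB : B.PosSemidef := by
    refine Matrix.PosSemidef.of_dotProduct_mulVec_nonneg ?_ fun v => ?_
    · ext s t
      simpa [Matrix.conjTranspose_apply] using hBsymm t s
    · have hexp : star v ⬝ᵥ (B.mulVec v) = ∑ s, ∑ t, v s * v t * K (θ (pts s)) (pts t) := by
        simp only [dotProduct, Matrix.mulVec, star_trivial, Finset.mul_sum]
        exact Finset.sum_congr rfl fun s _ => Finset.sum_congr rfl fun t _ => by ring
      rw [hexp]
      let e := Fintype.equivFin ι
      have h := hRP (Fintype.card ι) (pts ∘ e.symm) (v ∘ e.symm) (fun i => hx _ _)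
      simp only [Function.comp_apply] at h
      rwa [Fintype.sum_equiv e.symm
        (fun i => ∑ j, v (e.symm i) * v (e.symm j) * K (θ (pts (e.symm i))) (pts (e.symm j)))
        (fun s => ∑ t, v s * v t * K (θ (pts s)) (pts t))
        (fun i => Fintype.sum_equiv e.symm _ _ (fun j => rfl))] at h
  have hMsymm : ∀ s t, M s t = M t s := by
    intro s t
    show K (pts s) (pts t) - B s t = K (pts t) (pts s) - B t s
    rw [hK, hBsymm]
  have hDsymm : ∀ s t, D s t = D t s := by
    intro s t
    by_cases hst : s = t
    · subst hst; rfl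
    · have hts : ¬ t = s := fun h => hst h.symm
      simp only [D, hst, hts, if_false, hMsymm s t]
  have hD : D.PosSemidef := by
    refine posSemidef_of_diag_dominant D hDsymm fun s => ?_
    have hDs : D s s = (∑ u, |M s u|) + 1 := by simp [D]
    rw [hDs]
    have hle : ∑ t, (if s = t then 0 else |D s t|) ≤ ∑ u, |M s u| := by
      refine Finset.sum_le_sum fun t _ => ?_
      by_cases hst : s = t
      · simp [hst]
      · simp [D, hst]
    linarith
  -- §3.2 the measures and the process
  let E := EuclideanSpace ℝ ι
  let μU : Measure E := multivariateGaussian 0 B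
  let μV : Measure E := multivariateGaussian 0 D
  let P : Measure (E × (E × E)) := μU.prod (μV.prod μV)
  let X : Fin 5 × ι → (E × (E × E)) → ℝ := fun js ω =>
    if js.1 = 0 then ω.1 js.2 + ω.2.1 js.2 else if js.1 = 1 then ω.1 js.2 + ω.2.2 js.2
    else if js.1 = 2 then ω.1 js.2 else if js.1 = 3 then ω.2.1 js.2 else ω.2.2 js.2
  have hX : IsGaussianProcess X P := isGaussianProcess_coupling μU μV μV
  have hPprob : IsProbabilityMeasure P := hX.isProbabilityMeasure
  have hX0 : ∀ s ω, X (0, s) ω = ω.1 s + ω.2.1 s := fun s ω => by simp [X]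
  have hX1 : ∀ s ω, X (1, s) ω = ω.1 s + ω.2.2 s := fun s ω => by simp [X]
  have hX2 : ∀ s ω, X (2, s) ω = ω.1 s := fun s ω => by simp [X]
  have hX3 : ∀ s ω, X (3, s) ω = ω.2.1 s := fun s ω => by simp [X]
  have hX4 : ∀ s ω, X (4, s) ω = ω.2.2 s := fun s ω => by simp [X]
  -- raw first moments
  have hU0 : ∀ s, ∫ ω, ω.1 s ∂P = 0 := by
    intro s
    have h := integral_fun_fst (μ := μU) (ν := μV.prod μV) (fun u : E => u s)
    rw [h, probReal_univ, one_smul]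
    exact integral_eval_multivariateGaussian_zero B s
  have hV0 : ∀ s, ∫ ω, ω.2.1 s ∂P = 0 := by
    intro s
    have h := integral_fun_snd (μ := μU) (ν := μV.prod μV) (fun w : E × E => w.1 s)
    rw [h, probReal_univ, one_smul, integral_fun_fst (fun v : E => v s), probReal_univ, one_smul]
    exact integral_eval_multivariateGaussian_zero D s
  have hV'0 : ∀ s, ∫ ω, ω.2.2 s ∂P = 0 := by
    intro s
    have h := integral_fun_snd (μ := μU) (ν := μV.prod μV) (fun w : E × E => w.2 s)
    rw [h, probReal_univ, one_smul, integral_fun_snd (fun v : E => v s), probReal_univ, one_smul]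
    exact integral_eval_multivariateGaussian_zero D s
  have h0 : ∀ t, ∫ ω, X t ω ∂P = 0 := by
    rintro ⟨j, s⟩
    have hi1 : Integrable (fun ω : E × (E × E) => ω.1 s) P := by
      have := integrable_prod hX (Finset.univ : Finset (Fin 1)) (fun _ => ((2 : Fin 5), s))
      simpa [hX2] using this
    have hi2 : Integrable (fun ω : E × (E × E) => ω.2.1 s) P := by
      have := integrable_prod hX (Finset.univ : Finset (Fin 1)) (fun _ => ((3 : Fin 5), s))
      simpa [hX3] using this
    have hi3 : Integrable (fun ω : E × (E × E) => ω.2.2 s) P := by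
      have := integrable_prod hX (Finset.univ : Finset (Fin 1)) (fun _ => ((4 : Fin 5), s))
      simpa [hX4] using this
    simp only [X]
    split_ifs
    · rw [integral_add hi1 hi2, hU0, hV0, add_zero]
    · rw [integral_add hi1 hi3, hU0, hV'0, add_zero]
    · exact hU0 s
    · exact hV0 s
    · exact hV'0 s
  -- raw second moments
  have hUU : ∀ s t, ∫ ω, ω.1 s * ω.1 t ∂P = B s t := by
    intro s t
    have h := integral_fun_fst (μ := μU) (ν := μV.prod μV) (fun u : E => u s * u t)
    rw [h, probReal_univ, one_smul]
    exact integral_eval_mul_eval_multivariateGaussian hB s t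
  have hVV : ∀ s t, ∫ ω, ω.2.1 s * ω.2.1 t ∂P = D s t := by
    intro s t
    have h := integral_fun_snd (μ := μU) (ν := μV.prod μV) (fun w : E × E => w.1 s * w.1 t)
    rw [h, probReal_univ, one_smul, integral_fun_fst (fun v : E => v s * v t), probReal_univ, one_smul]
    exact integral_eval_mul_eval_multivariateGaussian hD s t
  have hV'V' : ∀ s t, ∫ ω, ω.2.2 s * ω.2.2 t ∂P = D s t := by
    intro s t
    have h := integral_fun_snd (μ := μU) (ν := μV.prod μV) (fun w : E × E => w.2 s * w.2 t)
    rw [h, probReal_univ, one_smul, integral_fun_snd (fun v : E => v s * v t), probReal_univ, one_smul]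
    exact integral_eval_mul_eval_multivariateGaussian hD s t
  have hUV : ∀ s t, ∫ ω, ω.1 s * ω.2.1 t ∂P = 0 := by
    intro s t
    have h := integral_prod_mul (μ := μU) (ν := μV.prod μV) (fun u : E => u s) (fun w : E × E => w.1 t)
    rw [h, integral_eval_multivariateGaussian_zero B s, zero_mul]
  have hUV' : ∀ s t, ∫ ω, ω.1 s * ω.2.2 t ∂P = 0 := by
    intro s t
    have h := integral_prod_mul (μ := μU) (ν := μV.prod μV) (fun u : E => u s) (fun w : E × E => w.2 t)
    rw [h, integral_eval_multivariateGaussian_zero B s, zero_mul]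
  have hVV' : ∀ s t, ∫ ω, ω.2.1 s * ω.2.2 t ∂P = 0 := by
    intro s t
    have h := integral_fun_snd (μ := μU) (ν := μV.prod μV) (fun w : E × E => w.1 s * w.2 t)
    rw [h, probReal_univ, one_smul, integral_prod_mul (fun v : E => v s) (fun v : E => v t),
      integral_eval_multivariateGaussian_zero D s, zero_mul]
  -- integrability of raw pair products (from the Gaussian process)
  have hint2 : ∀ (j j' : Fin 5) (s t : ι), Integrable (fun ω => X (j, s) ω * X (j', t) ω) P := by
    intro j j' s t
    have := integrable_prod hX (Finset.univ : Finset (Fin 2)) ![((j, s) : Fin 5 × ι), (j', t)]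
    simpa [Fin.prod_univ_two] using this
  -- second moments of `ξ`, `η`
  have hξξ : ∀ s t, s ≠ t → ∫ ω, X (0, s) ω * X (0, t) ω ∂P = K (pts s) (pts t) := by
    intro s t hst
    have hsplit : ∀ ω : E × (E × E), X (0, s) ω * X (0, t) ω =
        (ω.1 s * ω.1 t + ω.1 s * ω.2.1 t) + (ω.2.1 s * ω.1 t + ω.2.1 s * ω.2.1 t) := by
      intro ω; rw [hX0, hX0]; ring
    have i1 : Integrable (fun ω : E × (E × E) => ω.1 s * ω.1 t) P := by simpa [hX2] using hint2 2 2 s t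
    have i2 : Integrable (fun ω : E × (E × E) => ω.1 s * ω.2.1 t) P := by simpa [hX2, hX3] using hint2 2 3 s t
    have i3 : Integrable (fun ω : E × (E × E) => ω.2.1 s * ω.1 t) P := by simpa [hX2, hX3] using hint2 3 2 s t
    have i4 : Integrable (fun ω : E × (E × E) => ω.2.1 s * ω.2.1 t) P := by simpa [hX3] using hint2 3 3 s t
    have i12 : Integrable (fun ω : E × (E × E) => ω.1 s * ω.1 t + ω.1 s * ω.2.1 t) P := i1.add i2
    have i34 : Integrable (fun ω : E × (E × E) => ω.2.1 s * ω.1 t + ω.2.1 s * ω.2.1 t) P := i3.add i4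
    simp_rw [hsplit]
    rw [integral_add i12 i34, integral_add i1 i2, integral_add i3 i4, hUU, hUV, hVV]
    have h3 : ∫ ω, ω.2.1 s * ω.1 t ∂P = 0 := by
      rw [← hUV t s]; exact integral_congr_ae (ae_of_all _ fun ω => mul_comm _ _)
    rw [h3]
    simp [D, M, hst]
  have hηη : ∀ s t, s ≠ t → ∫ ω, X (1, s) ω * X (1, t) ω ∂P = K (pts s) (pts t) := by
    intro s t hst
    have hsplit : ∀ ω : E × (E × E), X (1, s) ω * X (1, t) ω =
        (ω.1 s * ω.1 t + ω.1 s * ω.2.2 t) + (ω.2.2 s * ω.1 t + ω.2.2 s * ω.2.2 t) := by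
      intro ω; rw [hX1, hX1]; ring
    have i1 : Integrable (fun ω : E × (E × E) => ω.1 s * ω.1 t) P := by simpa [hX2] using hint2 2 2 s t
    have i2 : Integrable (fun ω : E × (E × E) => ω.1 s * ω.2.2 t) P := by simpa [hX2, hX4] using hint2 2 4 s t
    have i3 : Integrable (fun ω : E × (E × E) => ω.2.2 s * ω.1 t) P := by simpa [hX2, hX4] using hint2 4 2 s t
    have i4 : Integrable (fun ω : E × (E × E) => ω.2.2 s * ω.2.2 t) P := by simpa [hX4] using hint2 4 4 s t
    have i12 : Integrable (fun ω : E × (E × E) => ω.1 s * ω.1 t + ω.1 s * ω.2.2 t) P := i1.add i2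
    have i34 : Integrable (fun ω : E × (E × E) => ω.2.2 s * ω.1 t + ω.2.2 s * ω.2.2 t) P := i3.add i4
    simp_rw [hsplit]
    rw [integral_add i12 i34, integral_add i1 i2, integral_add i3 i4, hUU, hUV', hV'V']
    have h3 : ∫ ω, ω.2.2 s * ω.1 t ∂P = 0 := by
      rw [← hUV' t s]; exact integral_congr_ae (ae_of_all _ fun ω => mul_comm _ _)
    rw [h3]
    simp [D, M, hst]
  have hξη : ∀ s t, ∫ ω, X (0, s) ω * X (1, t) ω ∂P = K (θ (pts s)) (pts t) := by
    intro s t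
    have hsplit : ∀ ω : E × (E × E), X (0, s) ω * X (1, t) ω =
        (ω.1 s * ω.1 t + ω.1 s * ω.2.2 t) + (ω.2.1 s * ω.1 t + ω.2.1 s * ω.2.2 t) := by
      intro ω; rw [hX0, hX1]; ring
    have i1 : Integrable (fun ω : E × (E × E) => ω.1 s * ω.1 t) P := by simpa [hX2] using hint2 2 2 s t
    have i2 : Integrable (fun ω : E × (E × E) => ω.1 s * ω.2.2 t) P := by simpa [hX2, hX4] using hint2 2 4 s t
    have i3 : Integrable (fun ω : E × (E × E) => ω.2.1 s * ω.1 t) P := by simpa [hX2, hX3] using hint2 3 2 s t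
    have i4 : Integrable (fun ω : E × (E × E) => ω.2.1 s * ω.2.2 t) P := by simpa [hX3, hX4] using hint2 3 4 s t
    have i12 : Integrable (fun ω : E × (E × E) => ω.1 s * ω.1 t + ω.1 s * ω.2.2 t) P := i1.add i2
    have i34 : Integrable (fun ω : E × (E × E) => ω.2.1 s * ω.1 t + ω.2.1 s * ω.2.2 t) P := i3.add i4
    simp_rw [hsplit]
    rw [integral_add i12 i34, integral_add i1 i2, integral_add i3 i4, hUU, hUV', hVV']
    have h3 : ∫ ω, ω.2.1 s * ω.1 t ∂P = 0 := by
      rw [← hUV t s]; exact integral_congr_ae (ae_of_all _ fun ω => mul_comm _ _)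
    rw [h3]
    simp [B]
  have hηξ : ∀ s t, ∫ ω, X (1, s) ω * X (0, t) ω ∂P = K (pts s) (θ (pts t)) := by
    intro s t
    have h := hξη t s
    simp_rw [mul_comm (X (0, t) _)] at h
    rw [h, hK]
  -- §3.3 termwise Wick: each hafnian is a mixed moment of the coupling
  let idx : (a b : Fin m) → Fin (k a + k b) → Fin 5 × ι := fun a b =>
    Fin.append (fun i => ((0 : Fin 5), (⟨a, i⟩ : ι))) (fun j => ((1 : Fin 5), (⟨b, j⟩ : ι)))
  have hprod : ∀ a b ω, ∏ l, X (idx a b l) ω = (∏ i, X (0, ⟨a, i⟩) ω) * ∏ j, X (1, ⟨b, j⟩) ω := by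
    intro a b ω
    rw [Fin.prod_univ_add]
    simp only [idx, Fin.append_left, Fin.append_right]
  have hterm : ∀ a b : Fin m,
      (if h : Even (k a + k b) then
        pairingSum K ((k a + k b) / 2)
          (fun i => Fin.append (fun i => θ (x a i)) (x b) (Fin.cast (Nat.two_mul_div_two_of_even h) i))
       else 0) = ∫ ω, (∏ i, X (0, ⟨a, i⟩) ω) * ∏ j, X (1, ⟨b, j⟩) ω ∂P := by
    intro a b
    let z : Fin (k a + k b) → α := Fin.append (fun i => θ (x a i)) (x b)
    -- the covariance at two distinct positions is the kernel at the two points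
    have hcov : ∀ u u' : Fin (k a + k b), u ≠ u' →
        ∫ ω, X (idx a b u) ω * X (idx a b u') ω ∂P = K (z u) (z u') := by
      intro u u' huu
      induction u using Fin.addCases with
      | left i =>
        induction u' using Fin.addCases with
        | left i' =>
          have hii : i ≠ i' := fun h => huu (by rw [h])
          simp only [idx, z, Fin.append_left]
          rw [hξξ _ _ (fun h => hii (eq_of_heq (Sigma.mk.inj h).2)), hθK]
        | right j' =>
          simp only [idx, z, Fin.append_left, Fin.append_right]
          rw [hξη]
      | right j =>
        induction u' using Fin.addCases with
        | left i' =>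
          simp only [idx, z, Fin.append_left, Fin.append_right]
          rw [hηξ]
        | right j' =>
          have hjj : j ≠ j' := fun h => huu (by rw [h])
          simp only [idx, z, Fin.append_right]
          rw [hηη _ _ (fun h => hjj (eq_of_heq (Sigma.mk.inj h).2))]
    simp_rw [← hprod]
    by_cases hev : Even (k a + k b)
    · rw [dif_pos hev]
      have hn : 2 * ((k a + k b) / 2) = k a + k b := Nat.two_mul_div_two_of_even hev
      have hre : ∀ ω, ∏ l, X (idx a b l) ω =
          ∏ i : Fin (2 * ((k a + k b) / 2)), X (idx a b (Fin.cast hn i)) ω := fun ω =>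
        (Fintype.prod_equiv (finCongr hn) (fun i => X (idx a b (Fin.cast hn i)) ω)
          (fun l => X (idx a b l) ω) (fun _ => rfl)).symm
      simp_rw [hre]
      rw [integral_prod_eq_pairingSum hX h0 ((k a + k b) / 2) (fun i => idx a b (Fin.cast hn i))]
      exact pairingSum_congr_of_ne K _ _ _ _ fun i j hij =>
        (hcov _ _ (fun h => hij ((finCongr hn).injective h))).symm
    · rw [dif_neg hev]
      have hodd : (k a + k b) % 2 = 1 := Nat.odd_iff.mp (Nat.not_even_iff_odd.mp hev)
      have hn : 2 * ((k a + k b) / 2) + 1 = k a + k b := by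
        have := Nat.div_add_mod (k a + k b) 2
        omega
      have hre : ∀ ω, ∏ l, X (idx a b l) ω =
          ∏ i : Fin (2 * ((k a + k b) / 2) + 1), X (idx a b (Fin.cast hn i)) ω := fun ω =>
        (Fintype.prod_equiv (finCongr hn) (fun i => X (idx a b (Fin.cast hn i)) ω)
          (fun l => X (idx a b l) ω) (fun _ => rfl)).symm
      simp_rw [hre]
      rw [integral_prod_odd_eq_zero hX h0 ((k a + k b) / 2) (fun i => idx a b (Fin.cast hn i))]
  -- §3.4 summation: `∑ c_a c_b G(θA^a ⊔ A^b) = E[F(ξ) F(η)] ≥ 0`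
  have hintab : ∀ a b, Integrable (fun ω => (∏ i, X (0, ⟨a, i⟩) ω) * ∏ j, X (1, ⟨b, j⟩) ω) P := by
    intro a b
    have h := integrable_prod hX Finset.univ (idx a b)
    simp_rw [hprod] at h
    exact h
  let F : (ι → ℝ) → ℝ := fun w => ∑ a, c a * ∏ i, w ⟨a, i⟩
  have hF : ∀ ω : E × (E × E), F (fun s => ω.1 s + ω.2.1 s) * F (fun s => ω.1 s + ω.2.2 s) =
      ∑ a, ∑ b, c a * c b * ((∏ i, X (0, ⟨a, i⟩) ω) * ∏ j, X (1, ⟨b, j⟩) ω) := by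
    intro ω
    simp only [F, hX0, hX1]
    rw [Finset.sum_mul_sum]
    exact Finset.sum_congr rfl fun a _ => Finset.sum_congr rfl fun b _ => by ring
  have hFint : Integrable (fun ω : E × (E × E) =>
      F (fun s => ω.1 s + ω.2.1 s) * F (fun s => ω.1 s + ω.2.2 s)) P := by
    rw [funext hF]
    exact integrable_finsetSum _ fun a _ => integrable_finsetSum _ fun b _ => (hintab a b).const_mul _
  calc (0 : ℝ) ≤ ∫ ω, F (fun s => ω.1 s + ω.2.1 s) * F (fun s => ω.1 s + ω.2.2 s) ∂P :=
        integral_coupling_nonneg μU μV F hFint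
    _ = ∫ ω, ∑ a, ∑ b, c a * c b * ((∏ i, X (0, ⟨a, i⟩) ω) * ∏ j, X (1, ⟨b, j⟩) ω) ∂P := by
        simp_rw [hF]
    _ = ∑ a, ∑ b, c a * c b * ∫ ω, (∏ i, X (0, ⟨a, i⟩) ω) * ∏ j, X (1, ⟨b, j⟩) ω ∂P := by
        rw [integral_finsetSum _ fun a _ =>
          integrable_finsetSum _ fun b _ => (hintab a b).const_mul _]
        refine Finset.sum_congr rfl fun a _ => ?_
        rw [integral_finsetSum _ fun b _ => (hintab a b).const_mul _]
        refine Finset.sum_congr rfl fun b _ => ?_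
        rw [integral_const_mul]
    _ = _ := Finset.sum_congr rfl fun a _ => Finset.sum_congr rfl fun b _ => by rw [hterm a b]

end Summit.CriticalPhenomena.Ising3DConformalLimit.RotationUpgradeFromTwoPointNegative

end
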